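import Mathlib.RingTheory.PowerSeries.Derivative
import Mathlib.Algebra.Ring.GeomSum
import Mathlib.Algebra.Polynomial.Coeff
import Mathlib.Data.Real.Basic
import HarnessLib

/-!
# Ford's counterexamples to a fixed-level asymptotic sieve: the two generating-function identities

Topic `Literature/NumberTheory/Sieve`, companion of `FordAsymptoticSieve.lean` (the named fact
`Literature.NumberTheory.Sieve.Ford2004_localConstruction` = [Ford2004] Theorem 3 with the choice of
`f_{1_M}` of the proof of Theorem 1). Source: K. Ford, *On Bombieri's asymptotic sieve*, Trans. Amer.
Math. Soc. **357** (2005) 1663–1674 (arXiv math/0401215) [Ford2004], §3 (arXiv pp. 7–8).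

The construction of [Ford2004] §3 rests on two finite identities, both proved there "by considering
the generating function". This file PROVES them (everything here is a theorem; no definitions):

* `Ford2004.gamma_eq` — (3.9)–(3.10): for `m ≥ 1`,
  `γ_m = ∑_{r=1}^{m} ((−1)^r/r!) ∑_{d_1+⋯+d_r = m, d_i ≥ 1} 1/(d_1⋯d_r)` is `−1` for `m = 1` and `0`
  for `m ≥ 2` (`∑_m γ_m z^m = exp(log(1 − z)) − 1 = −z`); this is what makes
  `e_α = (−1)^{Σ(α)+|α|}/(α_1⋯α_r)` solve the linear system (3.8), hence (3.4), (3.2) and (2.4).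
* `Ford2004.W_eq` — (3.13)–(3.14): for `M ≥ 1`, `W(M,0) = 1`, `W(M,1) = −1` and `W(M,N) = 0` for
  `N ≥ 2` (`∑ W(M,N) x^M y^N = (1 − xy)/(1 − x) − 1`), the identity behind the `Λ_k`-asymptotic
  (3.12) of Theorem 3.

Method (a finite form of the exponential formula, `Ford2004.expFormula_recursion`): for
`W ∈ R⟦X⟧` with zero constant term and `u_r` with `(r+1) u_{r+1} = u_r` (`u_r = 1/r!`), the
coefficients `e_m = ∑_{r ≤ m} u_r [X^m] W^r` of `∑_r u_r W^r` satisfy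
`(m+1) e_{m+1} = ∑_{i+j=m} e_i (j+1) [X^{j+1}] W` (the coefficient form of `E' = W'E`, via Mathlib's
`PowerSeries.derivative`); with `R = ℝ`, `W = log(1 − X)` this forces `e = (1, −1, 0, 0, …)`, and with
`R = ℝ[Y]`, `W = log(1 − XY) − log(1 − X)` it forces `e_m = 1 − Y` (`m ≥ 1`), whose `Y^N`-coefficient
is `W(M,N)`. Ford's ordered tuples `(d_1,…,d_r)` of positive integers are the finitely supported
`d ∈ (range r).finsuppAntidiag m` with all `d i ≥ 1` (Mathlib's `PowerSeries.coeff_pow`), and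
`ε ∈ {0,1}^r` in (3.13) is encoded by `t = {i : ε_i = 1} ⊆ range r`.

What is NOT here: Lemma 2.2 and the analytic part of Theorem 3 (the functions `f_α`, (3.4)–(3.7)),
i.e. the discharge of `Ford2004_localConstruction` itself.

## References

* K. Ford, *On Bombieri's asymptotic sieve*, Trans. AMS 357 (2005), 1663–1674, §3, (3.8)–(3.10)
  and (3.12)–(3.14) [Ford2004] (held: arXiv math/0401215, read pp. 7–8).
-/

namespace Literature.NumberTheory.Sieve

namespace Ford2004

open Finset PowerSeries

variable {R : Type*} [CommRing R]

/-- If `W` has zero constant term then `[X^i] W^s = 0` for `i < s`. [folklore] -/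
theorem coeff_pow_eq_zero_of_lt {W : R⟦X⟧} (hW : constantCoeff W = 0) {i s : ℕ} (his : i < s) :
    coeff i (W ^ s) = 0 := by
  have hX : (X : R⟦X⟧) ∣ W := PowerSeries.X_dvd_iff.mpr hW
  obtain ⟨q, hq⟩ := pow_dvd_pow_of_dvd hX s
  rw [hq, PowerSeries.coeff_X_pow_mul', if_neg (not_le.mpr his)]

/-- **Exponential formula, recursion.** Let `W ∈ R⟦X⟧` have zero constant term, let `u : ℕ → R`
satisfy `(r+1) u_{r+1} = u_r` (e.g. `u_r = 1/r!`), and let `e_m = ∑_{r ≤ m} u_r [X^m] W^r` (the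
coefficients of `∑_r u_r W^r`, "`= exp W`"). Then `(m+1) e_{m+1} = ∑_{i+j=m} e_i (j+1) [X^{j+1}] W`
(the coefficient form of `E' = W' E`). [folklore] -/
theorem expFormula_recursion {W : R⟦X⟧} (hW : constantCoeff W = 0) {u : ℕ → R}
    (hu : ∀ r : ℕ, ((r : R) + 1) * u (r + 1) = u r) {e : ℕ → R}
    (he : ∀ m, e m = ∑ r ∈ range (m + 1), u r * coeff m (W ^ r)) (m : ℕ) :
    ((m : R) + 1) * e (m + 1) =
      ∑ p ∈ antidiagonal m, e p.1 * (((p.2 : R) + 1) * coeff (p.2 + 1) W) := by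
  -- the truncated exponentials `E_M = ∑_{r ≤ M} u_r W^r`
  set E : ℕ → R⟦X⟧ := fun M => ∑ r ∈ range (M + 1), C (u r) * W ^ r with hE
  -- coefficients of `E_M` below `M` are the `e_i`
  have hcoeffE : ∀ M i, i ≤ M → coeff i (E M) = e i := by
    intro M i hi
    rw [he, hE]
    simp only [map_sum, PowerSeries.coeff_C_mul]
    -- terms `r > i` vanish
    rw [← Finset.sum_range_add_sum_Ico _ (show i + 1 ≤ M + 1 by omega)]
    rw [Finset.sum_eq_zero (s := Ico (i + 1) (M + 1)) fun r hr => by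
      rw [coeff_pow_eq_zero_of_lt hW (show i < r from (Finset.mem_Ico.mp hr).1), mul_zero], add_zero]
  -- derivative of `E_{m+1}` is `E_m · W'`
  have hD : derivative R (E (m + 1)) = E m * derivative R W := by
    rw [hE]
    simp only [map_sum]
    rw [Finset.sum_range_succ', pow_zero, mul_one, PowerSeries.derivative_C, add_zero, Finset.sum_mul]
    refine Finset.sum_congr rfl fun r _ => ?_
    rw [Derivation.leibniz, PowerSeries.derivative_C, smul_zero, add_zero, Derivation.leibniz_pow,
      Nat.add_sub_cancel, smul_eq_mul, ← hu r]
    -- `C(u (r+1)) • ((r+1) • W^r • W') = C((r+1) u(r+1)) W^r W'`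
    simp only [nsmul_eq_mul, smul_eq_mul, map_mul, map_add, map_natCast, map_one]
    push_cast
    ring
  -- compare the coefficients of `X^m`
  have h1 : coeff m (derivative R (E (m + 1))) = ((m : R) + 1) * e (m + 1) := by
    rw [PowerSeries.coeff_derivative, hcoeffE (m + 1) (m + 1) le_rfl, mul_comm]
  have h2 : coeff m (E m * derivative R W) =
      ∑ p ∈ antidiagonal m, e p.1 * (((p.2 : R) + 1) * coeff (p.2 + 1) W) := by
    rw [PowerSeries.coeff_mul]
    refine Finset.sum_congr rfl fun p hp => ?_
    rw [hcoeffE m p.1 (Finset.HasAntidiagonal.antidiagonal.fst_le hp), PowerSeries.coeff_derivative, mul_comm (coeff _ W)]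
  rw [← h1, hD, h2]


/-! ## [Ford2004] (3.9)–(3.10): `γ_m = 0` for `m ≥ 2` (`exp(log(1 − z)) − 1 = −z`) -/

/-- The coefficients `e_m = ∑_{r ≤ m} (1/r!) [X^m] W^r` of `exp(W)` for `W = −∑_{d ≥ 1} X^d/d = log(1 − X)`
are `e_0 = 1`, `e_1 = −1`, `e_m = 0` (`m ≥ 2`): the recursion `(m+1) e_{m+1} = −∑_{i ≤ m} e_i`
(`E' = W'E = −E/(1−X)`), i.e. `exp(log(1 − X)) = 1 − X` ([Ford2004], display after (3.10)). The
weight `−1/d` is `0` at `d = 0` by the convention `0⁻¹ = 0`. [cite: Ford2004, §3 (3.10)] -/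
theorem exp_log_one_sub_coeff (m : ℕ) :
    ∑ r ∈ range (m + 1), ((r.factorial : ℝ))⁻¹ *
        coeff m ((PowerSeries.mk fun d : ℕ => -((d : ℝ)⁻¹)) ^ r)
      = if m = 0 then 1 else if m = 1 then -1 else 0 := by
  set W : ℝ⟦X⟧ := PowerSeries.mk fun d : ℕ => -((d : ℝ)⁻¹) with hWdef
  set e : ℕ → ℝ := fun m => ∑ r ∈ range (m + 1), ((r.factorial : ℝ))⁻¹ * coeff m (W ^ r) with hedef
  have hW : constantCoeff W = 0 := by
    rw [← PowerSeries.coeff_zero_eq_constantCoeff_apply, hWdef, PowerSeries.coeff_mk]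
    simp
  have hu : ∀ r : ℕ, ((r : ℝ) + 1) * (((r + 1).factorial : ℝ))⁻¹ = ((r.factorial : ℝ))⁻¹ := by
    intro r
    rw [Nat.factorial_succ]
    have hr : (r.factorial : ℝ) ≠ 0 := by positivity
    push_cast
    field_simp
  have hrec := expFormula_recursion (u := fun r : ℕ => ((r.factorial : ℝ))⁻¹) hW hu (e := e)
    (fun m => rfl)
  have hcoef : ∀ j : ℕ, ((j : ℝ) + 1) * coeff (j + 1) W = -1 := by
    intro j
    rw [hWdef, PowerSeries.coeff_mk]
    have hj : (j : ℝ) + 1 ≠ 0 := by positivity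
    push_cast
    field_simp
  have hrec' : ∀ m : ℕ, ((m : ℝ) + 1) * e (m + 1) = -∑ i ∈ range (m + 1), e i := by
    intro m
    rw [hrec m, Finset.Nat.sum_antidiagonal_eq_sum_range_succ_mk, ← Finset.sum_neg_distrib]
    refine Finset.sum_congr rfl fun k _ => ?_
    rw [hcoef, mul_neg_one]
  have he0 : e 0 = 1 := by
    simp [hedef]
  have he1 : e 1 = -1 := by
    have h := hrec' 0
    rw [Finset.sum_range_one, he0] at h
    simpa using h
  have he2 : ∀ m, 2 ≤ m → e m = 0 := by
    intro m hm
    induction m using Nat.strong_induction_on with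
    | _ m ih =>
      obtain ⟨n, rfl⟩ : ∃ n, m = n + 1 := ⟨m - 1, by omega⟩
      have h := hrec' n
      have hsum : ∑ i ∈ range (n + 1), e i = 0 := by
        rw [← Finset.sum_range_add_sum_Ico _ (show 2 ≤ n + 1 by omega),
          Finset.sum_eq_zero (s := Ico 2 (n + 1)) fun i hi =>
            ih i (Finset.mem_Ico.mp hi).2 (Finset.mem_Ico.mp hi).1]
        simp [Finset.sum_range_succ, he0, he1]
      rw [hsum, neg_zero] at h
      exact (mul_eq_zero.mp h).resolve_left (by positivity)
  change e m = _
  split_ifs with h0 h1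
  · rw [h0]; exact he0
  · rw [h1]; exact he1
  · exact he2 m (by omega)

/-- **[Ford2004] (3.9)–(3.10)**: for `m ≥ 1`,
`γ_m := ∑_{r=1}^{m} ((−1)^r / r!) ∑_{d_1+⋯+d_r = m, d_i ≥ 1} 1/(d_1 ⋯ d_r)` equals `−1` for `m = 1`
and `0` for `m ≥ 2` — the coefficients of `exp(log(1 − z)) − 1 = −z`. This is the identity that
makes `e_α = (−1)^{Σ(α)+|α|}/(α_1 ⋯ α_r)` ((3.9)) solve the system (3.8) (`γ_m = 0`, `2 ≤ m ≤ M`).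
Transcription: the ordered tuples `(d_1, …, d_r)` of positive integers with sum `m` are the
`d ∈ (range r).finsuppAntidiag m` with all `d i ≥ 1`. [cite: Ford2004, §3 (3.9)–(3.10)] -/
theorem gamma_eq (m : ℕ) (hm : 1 ≤ m) :
    ∑ r ∈ Icc 1 m, ((-1 : ℝ) ^ r / (r.factorial : ℝ)) *
        ∑ d ∈ ((range r).finsuppAntidiag m).filter (fun d => ∀ i ∈ range r, 1 ≤ d i),
          ∏ i ∈ range r, (1 : ℝ) / (d i)
      = if m = 1 then -1 else 0 := by
  have h := exp_log_one_sub_coeff m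
  rw [if_neg (by omega)] at h
  rw [← h, Finset.range_eq_Ico, Finset.sum_eq_sum_Ico_succ_bot (by omega : 0 < m + 1),
    pow_zero, PowerSeries.coeff_one, if_neg (by omega), mul_zero, zero_add,
    Finset.Ico_add_one_right_eq_Icc]
  refine Finset.sum_congr rfl fun r _ => ?_
  rw [PowerSeries.coeff_pow]
  -- drop the filter: tuples with a zero entry contribute `0`
  rw [Finset.sum_filter_of_ne fun d _ hne => ?_]
  · simp only [PowerSeries.coeff_mk]
    rw [Finset.mul_sum, Finset.mul_sum]
    refine Finset.sum_congr rfl fun d _ => ?_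
    have hprod : ∏ i ∈ range r, -((d i : ℝ)⁻¹) = (-1) ^ r * ∏ i ∈ range r, (1 : ℝ) / (d i) := by
      rw [← Finset.card_range r, ← Finset.prod_const, Finset.card_range, ← Finset.prod_mul_distrib]
      exact Finset.prod_congr rfl fun i _ => by ring
    rw [hprod]
    ring
  · -- `∏ 1/(d i) ≠ 0 → ∀ i, 1 ≤ d i`
    intro i hi
    by_contra h0
    push Not at h0
    have hdi : d i = 0 := by omega
    exact hne (Finset.prod_eq_zero hi (by rw [hdi]; simp))


/-! ## [Ford2004] (3.13)–(3.14): the numbers `W(M,N)` (`exp(log(1 − xy) − log(1 − x)) = (1 − xy)/(1 − x)`) -/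

/-- The coefficients `e_m ∈ ℝ[Y]` of `exp(W)` for `W = ∑_{d ≥ 1} (1 − Y^d) X^d/d = log(1 − XY) − log(1 − X)`
are `e_0 = 1` and `e_m = 1 − Y` for `m ≥ 1` (i.e. `exp(W) = (1 − XY)/(1 − X)`, [Ford2004] display
after (3.14)), from the recursion `(m+1) e_{m+1} = ∑_{i+j=m} e_i (1 − Y^{j+1})`. [cite: Ford2004, §3 (3.14)] -/
theorem exp_log_ratio_coeff (m : ℕ) :
    ∑ r ∈ range (m + 1), Polynomial.C (((r.factorial : ℝ))⁻¹) *
        coeff m ((PowerSeries.mk fun d : ℕ =>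
          Polynomial.C ((d : ℝ)⁻¹) * (1 - Polynomial.X ^ d)) ^ r)
      = if m = 0 then 1 else 1 - Polynomial.X := by
  set Y : Polynomial ℝ := Polynomial.X with hYdef
  set W : (Polynomial ℝ)⟦X⟧ := PowerSeries.mk fun d : ℕ => Polynomial.C ((d : ℝ)⁻¹) * (1 - Y ^ d)
    with hWdef
  set e : ℕ → Polynomial ℝ := fun m => ∑ r ∈ range (m + 1),
    Polynomial.C (((r.factorial : ℝ))⁻¹) * coeff m (W ^ r) with hedef
  have hW : constantCoeff W = 0 := by
    rw [← PowerSeries.coeff_zero_eq_constantCoeff_apply, hWdef, PowerSeries.coeff_mk]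
    simp
  have hu : ∀ r : ℕ, ((r : Polynomial ℝ) + 1) * Polynomial.C ((((r + 1).factorial : ℝ))⁻¹) =
      Polynomial.C (((r.factorial : ℝ))⁻¹) := by
    intro r
    rw [← map_natCast Polynomial.C r, ← Polynomial.C_1, ← Polynomial.C_add, ← Polynomial.C_mul]
    congr 1
    rw [Nat.factorial_succ]
    have hr : (r.factorial : ℝ) ≠ 0 := by positivity
    push_cast
    field_simp
  have hrec := expFormula_recursion (u := fun r : ℕ => Polynomial.C (((r.factorial : ℝ))⁻¹)) hW hu
    (e := e) (fun m => rfl)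
  have hcoef : ∀ j : ℕ, ((j : Polynomial ℝ) + 1) * coeff (j + 1) W = 1 - Y ^ (j + 1) := by
    intro j
    rw [hWdef, PowerSeries.coeff_mk, ← mul_assoc, ← map_natCast Polynomial.C j, ← Polynomial.C_1,
      ← Polynomial.C_add, ← Polynomial.C_mul]
    have hj : ((j : ℝ) + 1) * (((j + 1 : ℕ) : ℝ))⁻¹ = 1 := by
      have : (j : ℝ) + 1 ≠ 0 := by positivity
      push_cast
      field_simp
    rw [hj, Polynomial.C_1, one_mul]
  have hrec' : ∀ m : ℕ, ((m : Polynomial ℝ) + 1) * e (m + 1) =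
      ∑ k ∈ range (m + 1), e k * (1 - Y ^ (m - k + 1)) := by
    intro m
    rw [hrec m, Finset.Nat.sum_antidiagonal_eq_sum_range_succ_mk]
    refine Finset.sum_congr rfl fun k _ => ?_
    dsimp only
    rw [hcoef]
  have he0 : e 0 = 1 := by
    simp [hedef]
  have he : ∀ m, 1 ≤ m → e m = 1 - Y := by
    intro m hm
    induction m using Nat.strong_induction_on with
    | _ m ih =>
      obtain ⟨n, rfl⟩ : ∃ n, m = n + 1 := ⟨m - 1, by omega⟩
      have h := hrec' n
      rw [Finset.sum_range_succ', he0, one_mul, Nat.sub_zero] at h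
      have h2 : ∑ k ∈ range n, e (k + 1) * (1 - Y ^ (n - (k + 1) + 1)) =
          (1 - Y) * ∑ k ∈ range n, (1 - Y ^ (k + 1)) := by
        rw [Finset.mul_sum, ← Finset.sum_range_reflect]
        refine Finset.sum_congr rfl fun k hk => ?_
        have hk' := Finset.mem_range.mp hk
        rw [show n - 1 - k + 1 = n - k by omega, show n - (n - k) + 1 = k + 1 by omega,
          ih (n - k) (by omega) (by omega)]
      have h3 : ∑ k ∈ range n, (1 - Y ^ (k + 1)) = n - Y * ∑ k ∈ range n, Y ^ k := by
        rw [Finset.sum_sub_distrib, Finset.sum_const, Finset.card_range, Finset.mul_sum]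
        simp [pow_succ']
      have h4 : (1 - Y) * (Y * ∑ k ∈ range n, Y ^ k) = Y * (1 - Y ^ n) := by
        have := mul_geom_sum Y n
        linear_combination (-Y) * this
      have h5 : ((n : Polynomial ℝ) + 1) * e (n + 1) = ((n : Polynomial ℝ) + 1) * (1 - Y) := by
        rw [h, h2, h3, mul_sub, h4]
        ring
      have hn : (n : Polynomial ℝ) + 1 ≠ 0 := by
        rw [← map_natCast Polynomial.C n, ← Polynomial.C_1, ← Polynomial.C_add, Ne,
          Polynomial.C_eq_zero]
        positivity
      exact mul_left_cancel₀ hn h5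
  change e m = _
  split_ifs with h0
  · rw [h0]; exact he0
  · exact he m (by omega)

/-- **[Ford2004] (3.13)–(3.14)**: for `M ≥ 1` and every `N`, the number
`W(M,N) := ∑_{r=1}^{M} (1/r!) ∑_{d_1+⋯+d_r = M, d_i ≥ 1} (d_1 ⋯ d_r)^{−1}
  ∑_{ε_1,…,ε_r ∈ {0,1}, ε_1 d_1 + ⋯ + ε_r d_r = N} (−1)^{ε_1+⋯+ε_r}`
equals `1` for `N = 0`, `−1` for `N = 1` and `0` for `N ≥ 2` — the coefficients of
`exp(log(1 − xy) − log(1 − x)) − 1 = (1 − y)(x + x^2 + ⋯)` (this covers the printed range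
`2 ≤ N ≤ M` of (3.14)). This is the identity behind (3.12)–(3.13) (the `Λ_k`-sums of the
construction). Transcription: ordered tuples of positive integers with sum `M` are the
`d ∈ (range r).finsuppAntidiag M` with all `d i ≥ 1`, and `ε ∈ {0,1}^r` is encoded by the set
`t = {i : ε_i = 1} ⊆ range r` (`∑ ε_i d_i = ∑_{i ∈ t} d_i`, `∑ ε_i = |t|`).
[cite: Ford2004, §3 (3.13)–(3.14)] -/
theorem W_eq (M N : ℕ) (hM : 1 ≤ M) :
    ∑ r ∈ Icc 1 M, (1 / (r.factorial : ℝ)) *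
      ∑ d ∈ ((range r).finsuppAntidiag M).filter (fun d => ∀ i ∈ range r, 1 ≤ d i),
        (∏ i ∈ range r, (1 : ℝ) / (d i)) *
          ∑ t ∈ (range r).powerset.filter (fun t => ∑ i ∈ t, d i = N), (-1 : ℝ) ^ t.card
      = if N = 0 then 1 else if N = 1 then -1 else 0 := by
  have h := congrArg (fun p : Polynomial ℝ => p.coeff N) (exp_log_ratio_coeff M)
  rw [if_neg (by omega : M ≠ 0), Polynomial.coeff_sub, Polynomial.coeff_one, Polynomial.coeff_X,
    Polynomial.finsetSum_coeff] at h
  have hR : ((if N = 0 then (1 : ℝ) else 0) - if 1 = N then 1 else 0)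
      = if N = 0 then 1 else if N = 1 then -1 else 0 := by
    rcases N with _ | _ | N <;> simp
  rw [hR] at h
  rw [← h, Finset.range_eq_Ico, Finset.sum_eq_sum_Ico_succ_bot (by omega : 0 < M + 1), pow_zero,
    PowerSeries.coeff_one, if_neg (by omega : M ≠ 0), mul_zero, Polynomial.coeff_zero, zero_add,
    Finset.Ico_add_one_right_eq_Icc]
  refine Finset.sum_congr rfl fun r _ => ?_
  rw [Polynomial.coeff_C_mul, one_div, PowerSeries.coeff_pow, Polynomial.finsetSum_coeff,
    Finset.mul_sum, Finset.mul_sum]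
  rw [Finset.sum_filter_of_ne fun d _ hne => ?_]
  · refine Finset.sum_congr rfl fun d _ => ?_
    congr 1
    simp only [PowerSeries.coeff_mk]
    rw [Finset.prod_mul_distrib, ← map_prod Polynomial.C, Polynomial.coeff_C_mul]
    have hexp : (∏ i ∈ range r, (1 - (Polynomial.X : Polynomial ℝ) ^ d i))
        = ∑ t ∈ (range r).powerset,
            Polynomial.C ((-1 : ℝ) ^ t.card) * Polynomial.X ^ (∑ i ∈ t, d i) := by
      have h1 : ∀ i ∈ range r, (1 - (Polynomial.X : Polynomial ℝ) ^ d i)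
          = Polynomial.C (-1) * Polynomial.X ^ d i + 1 := by
        intro i _
        rw [map_neg, map_one]
        ring
      rw [Finset.prod_congr rfl h1, Finset.prod_add]
      refine Finset.sum_congr rfl fun t _ => ?_
      rw [Finset.prod_const_one, mul_one, Finset.prod_mul_distrib, Finset.prod_const, ← map_pow,
        Finset.prod_pow_eq_pow_sum]
    rw [hexp, Polynomial.finsetSum_coeff]
    simp only [Polynomial.coeff_C_mul, Polynomial.coeff_X_pow]
    rw [Finset.sum_filter]
    congr 1
    · exact Finset.prod_congr rfl fun i _ => one_div _
    · refine Finset.sum_congr rfl fun t _ => ?_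
      by_cases hs : ∑ i ∈ t, d i = N
      · rw [if_pos hs, if_pos hs.symm, mul_one]
      · rw [if_neg hs, if_neg (fun h' => hs h'.symm), mul_zero]
  · -- tuples with a zero entry contribute nothing
    intro i hi
    by_contra h0
    push Not at h0
    have hdi : d i = 0 := by omega
    apply hne
    rw [Finset.prod_eq_zero hi (by rw [hdi]; simp), zero_mul, mul_zero]

end Ford2004

end Literature.NumberTheory.Sieve
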